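/-
Copyright: statement-level skeleton of a published paper (lit-balaban cell, Phase-2 proof seat p18, gen 7). No claims beyond
what the kernel checks below.
-/
import Mathlib
import Literature.MathematicalPhysics.QuantumFieldTheory.Balaban1983to89.B3Prop22FreeLinesZeroBox

/-!
# B3 — T. Bałaban, *(Higgs)₂,₃ quantum fields in a finite volume. III. Renormalization*, CMP **88** (1983) 411–445
[Balaban1983Higgs3] — Proposition 2.2 p. 428: a member of the generalized zero-field box family with a GENUINELY SHIFTED line
dimension and a genuine propagator

statement-level skeleton of published theorems with citation tags; proofs where landed; nothing here is a claim about
the Yang–Mills mass gap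

Companion example of `B3Prop22FreeLinesZeroBox` (unit `lit-balaban-p18` gen 7, row **B3.Prop2.2** closing item «free line
exponent κ_l»).  Own namespace `…B3FreeLineZeroBox` (continued); definitions with bodies and theorems; no `def … : Prop`;
nothing existing is modified.

WHAT IS SHOWN.  The one-line graph on two vertices with NO derivative legs (`zb11`; line = the genuine undifferentiated cut-off
piece `ζ(x)ζ(y)η^{−(d+1)}G^η_{(t)}(□,0;x,y)`, `ampK_K_member11`) has the standard line dimension `1 − d` (`lineDimQ_zb11`) and
degree `2` in every dimension `d + 1` (`degQ_zb11`, by (2.2)); as a generalized graph `member11` of `famZK` with a menu exponent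
`q`, `−2 < q ≤ 0`, on its line (*"lines … with arbitrary dimensions instead of −d+2"*, here `1 − d + q`, the genuine piece obeying
(2.10) with that dimension) its only connected subgraph has generalized degree `2 + q > 0`, so the PRINTED hypothesis of
Proposition 2.1/2.2 holds with no exception (`posSubgraphsExcept24_member11`) and Proposition 2.2 for the family
(`prop21_zeroBoxK`) yields (1.33) for it, for every datum of p19's class (`ineq133At_member11`, unfolded `abs_Etot_member11_le`).
[cite: Balaban1983Higgs3, Prop. 2.2 p.428]
-/

open Finset

namespace Literature.MathematicalPhysics.QuantumFieldTheory.Balaban1983to89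

namespace B3FreeLineZeroBox

open B3Ineq215 B3Ineq213 B3FreeLine B3Sect2FirstEstimate B3Prop1
open B3Ineq213ZeroBoxLines (twoVertexGraph)
open B3IBPZeroBox B3IBPZeroBoxKernels

noncomputable section

/-! ## The undifferentiated one-line graph -/

/-- The one-line graph on two vertices with NO derivative legs (two vertices (1.6)/(1.7)-like, η-power `0`, one scalar line
`0 → 1`): its line is the genuine undifferentiated cut-off piece `ζ(x)ζ(y)η^{−(d+1)}G^η_{(t)}(□,0;x,y)`. [cite: Balaban1983Higgs3, Prop. 2.1 p.424] -/
def zb11 (d : ℕ) : SDGraph (Fin 2) 1 d where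
  toLineGraph := twoVertexGraph
  der := fun _ => none
  dir := fun _ => 0
  der_at := fun _ _ _ h => by cases h

section Graph11

variable {d : ℕ} (ℓ : ℕ) (hℓ : 1 ≤ ℓ) (amin aplus m2plus : ℝ) (ha : 0 < amin)

/-- No derivative on the first leg. [cite: Balaban1983Higgs3, (2.1) p.422] -/
theorem not_DS_zb11 : ¬ (zb11 d).DS 0 := by
  unfold SDGraph.DS zb11; simp

/-- No derivative on the second leg. [cite: Balaban1983Higgs3, (2.1) p.422] -/
theorem not_DT_zb11 : ¬ (zb11 d).DT 0 := by
  unfold SDGraph.DT zb11; simp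

/-- The count datum: the line is undifferentiated. [cite: Balaban1983Higgs3, (2.1) p.422] -/
theorem diffOn_zb11 (v : Fin 2) : (zbCounts (zb11 d) ℓ hℓ amin aplus m2plus ha).diffOn v 0 = 0 := by
  rw [zbCounts_diffOn, if_neg (not_DS_zb11 (d := d)), if_neg (not_DT_zb11 (d := d))]
  simp

/-- After shrinking the only line both vertices lie in the block of the first endpoint `0`. [cite: Balaban1983Higgs3, (2.16) p.428] -/
theorem rep_one_zb11 (v : Fin 2) : (zbCounts (zb11 d) ℓ hℓ amin aplus m2plus ha).toModel.rep 1 v = 0 := by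
  rw [(zbCounts (zb11 d) ℓ hℓ amin aplus m2plus ha).toModel.rep_succ Nat.zero_lt_one v]
  unfold Model.rho Model.bs Model.bt
  simp only [Model.rep_zero]
  fin_cases v <;> simp [zbCounts, B3Ineq213ZeroBoxDiffLines.dboxCounts, SDGraph.toDLineGraph, zb11, twoVertexGraph,
    Counts.toModel]

/-- The block `G₁` is the whole vertex set. [cite: Balaban1983Higgs3, (2.16) p.428] -/
theorem fiber_one_zb11 : (zbCounts (zb11 d) ℓ hℓ amin aplus m2plus ha).toModel.fiber 1 0 = univ := by
  ext v; simp [Model.mem_fiber, rep_one_zb11]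

/-- Its line set is the single line `0`. [cite: Balaban1983Higgs3, (2.16) p.428] -/
theorem before_one_zb11 : (zbCounts (zb11 d) ℓ hℓ amin aplus m2plus ha).toModel.before 1 0 = {0} := by
  ext l
  simp only [Model.mem_before, rep_one_zb11, and_true, mem_singleton, Fin.eq_zero l, Fin.val_zero, Nat.zero_lt_one]

/-- **`a = 2 − (d+1) = 1 − d`**: two scalar legs, no differentiation — the standard dimension of the scalar line in `d + 1`
dimensions. [cite: Balaban1983Higgs3, (2.14) p.427] -/
theorem lineDimQ_zb11 : lineDimQ (zbCounts (zb11 d) ℓ hℓ amin aplus m2plus ha) 0 = 1 - (d : ℚ) := by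
  have hd : ((zbCounts (zb11 d) ℓ hℓ amin aplus m2plus ha).d : ℚ) = (d : ℚ) + 1 := by
    simp [zbCounts, B3Ineq213ZeroBoxDiffLines.dboxCounts]
  have hv : ∀ v : Fin 2, ((zbCounts (zb11 d) ℓ hℓ amin aplus m2plus ha).vecLegAvg v 0 : ℚ) = 0 := fun v => by
    simp [zbCounts, B3Ineq213ZeroBoxDiffLines.dboxCounts]
  have hl : ∀ v : Fin 2, ((zbCounts (zb11 d) ℓ hℓ amin aplus m2plus ha).legsOn v 0 : ℚ) = 1 := fun v => by
    unfold Counts.legsOn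
    fin_cases v <;> simp [zbCounts, B3Ineq213ZeroBoxDiffLines.dboxCounts, SDGraph.toDLineGraph, zb11, twoVertexGraph]
  unfold lineDimQ legExpQ
  simp only [Fin.sum_univ_two, hd, hv, hl, diffOn_zb11, Nat.cast_zero]
  ring

/-- **Degree `2` in every dimension**: `D = 2(d+1) − (d+1) + (1 − d) = 2` by (2.2). [cite: Balaban1983Higgs3, (2.2) p.423] -/
theorem degQ_zb11 : degQ (zbCounts (zb11 d) ℓ hℓ amin aplus m2plus ha) 1 0 = 2 := by
  unfold degQ
  rw [fiber_one_zb11, before_one_zb11, sum_singleton, lineDimQ_zb11]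
  simp [zbCounts, B3Ineq213ZeroBoxDiffLines.dboxCounts, SDGraph.toDLineGraph, zb11, twoVertexGraph]
  ring

end Graph11

section Member11

variable (P : ParamsZK) (q : ℚ) (hq : q ∈ P.menu) (hq0 : q ≤ 0)

/-- The count datum of the undifferentiated one-line graph with the lattice constants of `P`. [cite: Balaban1983Higgs3, (2.14) p.427] -/
def G11 : Counts (Fin 2) 1 := zbCounts (zb11 P.d) P.ℓ P.hℓ P.amin P.aplus P.m2plus P.ha

/-- Relabelling along a permutation of `Fin 1` does nothing. [cite: Balaban1983Higgs3, (2.7) p.424] -/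
theorem relabelCounts_G11 (σ : Equiv.Perm (Fin 1)) : relabelCounts (G11 P) σ = G11 P := by
  rw [Subsingleton.elim σ (Equiv.refl _)]
  rfl

/-- Block representatives of `G11` after the only line. [cite: Balaban1983Higgs3, (2.16) p.428] -/
theorem rep_one_G11 (v : Fin 2) : (G11 P).toModel.rep 1 v = 0 :=
  rep_one_zb11 P.ℓ P.hℓ P.amin P.aplus P.m2plus P.ha v

/-- The line set of the block of `G11`. [cite: Balaban1983Higgs3, (2.16) p.428] -/
theorem before_one_G11 : (G11 P).toModel.before 1 0 = {0} :=
  before_one_zb11 P.ℓ P.hℓ P.amin P.aplus P.m2plus P.ha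

/-- The degree of `G11` is `2`. [cite: Balaban1983Higgs3, (2.2) p.423] -/
theorem degQ_G11 : degQ (G11 P) 1 0 = 2 :=
  degQ_zb11 P.ℓ P.hℓ P.amin P.aplus P.m2plus P.ha

/-- **The undifferentiated one-line graph with the menu exponent `q ≤ 0` on its line is a generalized graph of the family** at
every size bound `mb ≥ 1`: its line is the genuine piece, bounded with the dimension `1 − d + q`. [cite: Balaban1983Higgs3, Prop. 2.2 p.428] -/
def member11 {mb : ℕ} (h : 1 ≤ mb) : CGraphZK P mb :=
  CGraphZK.ofZB ⟨2, 1, h, zb11 P.d⟩ q hq hq0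

/-- Its line is the genuine undifferentiated cut-off piece `ζ(x)ζ(y)η^{−(d+1)}G^η_{(t)}(□,0;x,y)`. [cite: Balaban1983Higgs3, (2.10) p.426] -/
theorem ampK_K_member11 {mb : ℕ} (h : 1 ≤ mb) (D : DatumZB P.toParamsZB) (box : Fin 2 → Fin (P.d + 1) → ℕ) :
    (ampK D (member11 P q hq hq0 h) box).K (0 : Fin 1) = cutK P.ℓ D.k D.M D.a D.m2 := by
  show zbK (zb11 P.d) P.ℓ D.k D.M D.a D.m2 0 = _
  unfold zbK zbKb
  rw [if_neg (not_DS_zb11 (d := P.d)), if_neg (not_DT_zb11 (d := P.d))]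

/-- **The printed hypothesis HOLDS for this member whenever `−2 < q`**, with no exception needed: its only connected subgraph has
generalized degree `2 + q > 0`. [cite: Balaban1983Higgs3, Prop. 2.2 p.428] -/
theorem posSubgraphsExcept24_member11 (hq2 : -2 < q) {mb : ℕ} (h : 1 ≤ mb) (D : DatumZB P.toParamsZB) :
    PosSubgraphsExcept24 (expansionZK P mb D) (member11 P q hq hq0 h) := by
  refine ⟨trivial, ?_⟩
  show ∀ H : Component (G11 P),
    Is24K (relabelCounts (G11 P) H.1) ((fun _ : Fin 1 => q) ∘ H.1) H.2.1 H.2.2.1 ∨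
      0 < degQK (relabelCounts (G11 P) H.1) ((fun _ : Fin 1 => q) ∘ H.1) H.2.1 H.2.2.1
  rintro ⟨σ, i, b, hb, hn⟩
  right
  change 0 < degQK (relabelCounts (G11 P) σ) ((fun _ : Fin 1 => q) ∘ σ) i b
  rw [relabelCounts_G11] at hb hn ⊢
  have hi : (i : ℕ) = 0 ∨ (i : ℕ) = 1 := by have := i.isLt; omega
  rcases hi with hi | hi <;> rw [hi] at hb hn ⊢
  · exact absurd hn (by simp [Model.Nontriv, Model.before_zero])
  · have hb0 : b = 0 := by
      have := (G11 P).toModel.mem_reps.1 hb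
      rw [rep_one_G11] at this
      exact this.symm
    subst hb0
    unfold degQK
    rw [degQ_G11, before_one_G11, sum_singleton]
    show (0 : ℚ) < 2 + q
    linarith

/-- **(1.33) for the undifferentiated one-line graph with a genuinely lowered line dimension** (`−2 < q ≤ 0` from the menu) and
its genuine propagator piece, from Proposition 2.2 for the generalized family, for every datum of p19's class.
[cite: Balaban1983Higgs3, Prop. 2.2 p.428] -/
theorem ineq133At_member11 (hq2 : -2 < q) (mbar : ℕ → ℕ) :
    ∃ δ₀ : ℝ, 0 < δ₀ ∧ ∀ α₀ : ℝ, 0 < α₀ → α₀ < 1 → ∀ nbar : ℕ, ∃ C : ℝ, 0 < C ∧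
      ∀ (D : DatumZB P.toParamsZB) (h : 1 ≤ mbar nbar),
        Ineq133At (famZK P mbar nbar D).toExpansion (member11 P q hq hq0 h) α₀ δ₀ C := by
  obtain ⟨δ₀, hδ, H⟩ := prop21_zeroBoxK P mbar
  refine ⟨δ₀, hδ, fun α₀ ha0 ha1 nbar => ?_⟩
  obtain ⟨C, hC, HC⟩ := H α₀ ha0 ha1 nbar
  exact ⟨C, hC, fun D h => HC D _ (posSubgraphsExcept24_member11 P q hq hq0 hq2 h D)⟩

/-- The same, unfolded: `|E| ≤ O(1)·e^{Σd_v}λ^{Σd_s}e^{−δ₀d({□(v)})}Π N^Φ_v Π N^A_v` with `E` p19's total amplitude of the graph —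
the lattice sum with the genuine cut-off propagator piece on the line. [cite: Balaban1983Higgs3, (1.33) p.420, Prop. 2.2 p.428] -/
theorem abs_Etot_member11_le (hq2 : -2 < q) (mbar : ℕ → ℕ) :
    ∃ δ₀ : ℝ, 0 < δ₀ ∧ ∀ α₀ : ℝ, 0 < α₀ → α₀ < 1 → ∀ nbar : ℕ, ∃ C : ℝ, 0 < C ∧
      ∀ (D : DatumZB P.toParamsZB) (h : 1 ≤ mbar nbar) (box : Fin 2 → Fin (P.d + 1) → ℕ),
        |(D.amp (member11 P q hq hq0 h).toCGraphZB box).toAmp.Etot|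
          ≤ C * D.eRun ^ (∑ v, (D.vtx (zb11 P.d) boxZ).dv v) * D.lamRun ^ (∑ v, (D.vtx (zb11 P.d) boxZ).ds v)
            * Real.exp (-(δ₀ * boxTreeLen (P.ℓ + 1) D.k box))
            * (∏ v, (D.vtx (zb11 P.d) box).NPhi v) * (∏ v, (D.vtx (zb11 P.d) box).NA v) := by
  obtain ⟨δ₀, hδ, H⟩ := ineq133At_member11 P q hq hq0 hq2 mbar
  refine ⟨δ₀, hδ, fun α₀ ha0 ha1 nbar => ?_⟩
  obtain ⟨C, hC, HC⟩ := H α₀ ha0 ha1 nbar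
  exact ⟨C, hC, fun D h box => HC D h box () ()⟩

end Member11

end

end B3FreeLineZeroBox

end Literature.MathematicalPhysics.QuantumFieldTheory.Balaban1983to89
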